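import Summits.RiemannHypothesis.RiemannHypothesis.Theorems.EtaLeadingQuarterSecondMomentZerosZones
import HarnessLib

/-!
# The second moment of the sharp eta vector at the zeros, zero side VI: off the transition zones
(route EtaLeadingQuarter, item `EtaLeadingSecondMoment`, stmt-RiemannHypothesis-21791)

`γ_n = zetaOrdinate n`, `N(T) = zetaZeroCount T`, `y_n = γ_n/(πM)`, `d_n = |y_n − round y_n|`. Off the
transition zones the AFE error at a zero is `≍ M^{-1/2}/d_n`; its square summed with weight `M/γ²` is
`∑ 1/(γ_n² d_n²)`, bounded here (RH-free, engine-independent):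

* `inv_sq_le_sum_levels` — the dyadic cover `1/d² ≤ ∑_{i ≤ I} 4^{i+2} 1_{d ≤ 2^{-i-1}}`
  (`δ ≤ d ≤ 1/2`, `2^I ≥ 1/δ`);
* `level_le` — `∑_{n<N(T₂), y_n ≥ 1/2, d_n ≤ h} 1/γ_n² ≤ A (πMh + 1) log(T₂ + πM + 3)/M²` (`h ≤ 1/2`);
* `offZone_le` — `∑_{n<N(T₂), y_n ≥ 1/2, d_n ≥ δ} 1/(γ_n² d_n²) ≤ A log(T₂ + πM + 3)(101/(δM) + 86/(δ²M²))`.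

With `δ = δ_M` and `δ_M M / log M → ∞` this is `o(1)`. Nothing here bears on the truth of RH.
-/

noncomputable section

open Real Finset Filter Topology

set_option linter.dupNamespace false  -- the mandated namespace repeats `RiemannHypothesis`

namespace Summit.RiemannHypothesis.RiemannHypothesis.Theorems.EtaLeadingQuarter.Zeros

open Literature.NumberTheory.LFunctions

/-- **Dyadic cover of `1/d²`.** For `0 < δ ≤ d ≤ 1/2` and `2^I ≥ 1/δ`:
`1/d² ≤ ∑_{i=0}^{I} 4^{i+2} · 1_{d ≤ (1/2)^{i+1}}`. [folklore] -/
theorem inv_sq_le_sum_levels {d δ : ℝ} {I : ℕ} (hδ : 0 < δ) (hd : δ ≤ d) (hd2 : d ≤ 1 / 2)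
    (hI : 1 / δ ≤ 2 ^ I) :
    1 / d ^ 2 ≤ ∑ i ∈ Finset.range (I + 1), (4 : ℝ) ^ (i + 2) * (if d ≤ (1 / 2 : ℝ) ^ (i + 1) then 1 else 0) := by
  classical
  have hd0 : 0 < d := hδ.trans_le hd
  set S := (Finset.range (I + 1)).filter (fun i ↦ d ≤ (1 / 2 : ℝ) ^ (i + 1)) with hS
  have h0S : 0 ∈ S := by
    rw [hS, Finset.mem_filter, Finset.mem_range]
    exact ⟨by omega, by simpa using hd2⟩
  have hne : S.Nonempty := ⟨0, h0S⟩
  set i₀ := S.max' hne with hi₀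
  have hi₀S : i₀ ∈ S := Finset.max'_mem S hne
  rw [hS, Finset.mem_filter, Finset.mem_range] at hi₀S
  obtain ⟨hi₀I, hi₀d⟩ := hi₀S
  -- `1/d² ≤ 4^{i₀+2}`
  have hkey : 1 / d ^ 2 ≤ (4 : ℝ) ^ (i₀ + 2) := by
    by_cases hlt : i₀ < I
    · -- `i₀ + 1 ∉ S`
      have hnot : ¬ d ≤ (1 / 2 : ℝ) ^ (i₀ + 2) := by
        intro h
        have hmem : i₀ + 1 ∈ S := by
          rw [hS, Finset.mem_filter, Finset.mem_range]
          exact ⟨by omega, h⟩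
        have := Finset.le_max' S (i₀ + 1) hmem
        rw [← hi₀] at this
        omega
      rw [not_le] at hnot
      have hpos : 0 < (1 / 2 : ℝ) ^ (i₀ + 2) := by positivity
      have h1 : 1 / d ^ 2 ≤ 1 / ((1 / 2 : ℝ) ^ (i₀ + 2)) ^ 2 :=
        one_div_le_one_div_of_le (by positivity) (pow_le_pow_left₀ hpos.le hnot.le 2)
      have h2 : 1 / ((1 / 2 : ℝ) ^ (i₀ + 2)) ^ 2 = (4 : ℝ) ^ (i₀ + 2) := by
        rw [← pow_mul, mul_comm (i₀ + 2) 2, pow_mul, show ((1 : ℝ) / 2) ^ 2 = 1 / 4 by norm_num,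
          one_div_pow, one_div_one_div]
      linarith
    · have hi₀eq : i₀ = I := by omega
      have h1 : 1 / d ^ 2 ≤ 1 / δ ^ 2 := one_div_le_one_div_of_le (by positivity) (pow_le_pow_left₀ hδ.le hd 2)
      have h2 : 1 / δ ^ 2 ≤ (4 : ℝ) ^ I := by
        have h := pow_le_pow_left₀ (by positivity) hI 2
        rw [one_div_pow] at h
        calc 1 / δ ^ 2 ≤ ((2 : ℝ) ^ I) ^ 2 := h
          _ = (4 : ℝ) ^ I := by
              rw [← pow_mul, mul_comm, pow_mul]; norm_num
      have h3 : (4 : ℝ) ^ I ≤ 4 ^ (i₀ + 2) := by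
        rw [hi₀eq]; exact pow_le_pow_right₀ (by norm_num) (by omega)
      linarith
  -- the `i₀`-th term of the sum
  have hterm : (4 : ℝ) ^ (i₀ + 2) * (if d ≤ (1 / 2 : ℝ) ^ (i₀ + 1) then 1 else 0) = 4 ^ (i₀ + 2) := by
    rw [if_pos hi₀d, mul_one]
  calc 1 / d ^ 2 ≤ (4 : ℝ) ^ (i₀ + 2) := hkey
    _ = (4 : ℝ) ^ (i₀ + 2) * (if d ≤ (1 / 2 : ℝ) ^ (i₀ + 1) then 1 else 0) := hterm.symm
    _ ≤ ∑ i ∈ Finset.range (I + 1), (4 : ℝ) ^ (i + 2) * (if d ≤ (1 / 2 : ℝ) ^ (i + 1) then 1 else 0) := by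
        refine Finset.single_le_sum (f := fun i ↦ (4 : ℝ) ^ (i + 2) *
          (if d ≤ (1 / 2 : ℝ) ^ (i + 1) then 1 else 0)) (fun i _ ↦ ?_) (Finset.mem_range.2 (by omega))
        split_ifs <;> positivity

/-- **One level.** For `M ≥ 1`, `0 ≤ h ≤ 1/2`, `T₂ ≥ 0`:
`∑_{n<N(T₂), y_n ≥ 1/2, d_n ≤ h} 1/γ_n² ≤ A (πMh + 1) log(T₂ + πM + 3)/M²`. [folklore] -/
theorem level_le {A : ℝ} (hA0 : 0 ≤ A)
    (hA : ∀ t : ℝ, 0 ≤ t → (zetaZeroCount (t + 1) : ℝ) - zetaZeroCount t ≤ A * Real.log (t + 2))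
    {M : ℕ} (hM : 1 ≤ M) {h : ℝ} (hh0 : 0 ≤ h) (hh : h ≤ 1 / 2) {T₂ : ℝ} (hT₂ : 0 ≤ T₂)
    {S : Finset ℕ} (hS : ∀ n ∈ S, n < zetaZeroCount T₂ ∧ 1 / 2 ≤ zetaOrdinate n / (π * M) ∧
      |zetaOrdinate n / (π * M) - round (zetaOrdinate n / (π * M))| ≤ h) :
    ∑ n ∈ S, 1 / zetaOrdinate n ^ 2 ≤ A * (π * M * h + 1) * Real.log (T₂ + π * M + 3) / (M : ℝ) ^ 2 := by
  classical
  have hM1 : (1 : ℝ) ≤ M := by exact_mod_cast hM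
  have hπ := Real.pi_gt_three
  have hπM : 0 < π * (M : ℝ) := by positivity
  have hL0 : 0 ≤ Real.log (T₂ + π * M + 3) := Real.log_nonneg (by linarith)
  set cnt : ℝ := A * (2 * (π * M * h) + 2) * Real.log (T₂ + π * M + 3) with hcnt
  have hcnt0 : 0 ≤ cnt := by positivity
  rw [sum_eq_sum_fibre hM hT₂ (fun n ↦ 1 / zetaOrdinate n ^ 2) (fun n hn ↦ ⟨(hS n hn).1, (hS n hn).2.1⟩)]
  have hfib : ∀ k ∈ Finset.Icc 1 ⌊T₂ / (π * M) + 1 / 2⌋₊,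
      ∑ n ∈ S.filter (fun n ↦ round (zetaOrdinate n / (π * M)) = (k : ℤ)), 1 / zetaOrdinate n ^ 2 ≤
        cnt * (1 / (π * M * ((k : ℝ) - 1 / 2)) ^ 2) := by
    intro k hk
    rw [Finset.mem_Icc] at hk
    have hk1 : (1 : ℝ) ≤ k := by exact_mod_cast hk.1
    have hlow : 0 < π * M * ((k : ℝ) - 1 / 2) := by nlinarith
    have hpt : ∀ n ∈ S.filter (fun n ↦ round (zetaOrdinate n / (π * M)) = (k : ℤ)),
        1 / zetaOrdinate n ^ 2 ≤ 1 / (π * M * ((k : ℝ) - 1 / 2)) ^ 2 := by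
      intro n hn
      rw [Finset.mem_filter] at hn
      have h := (fibre_lower hM hn.2).1
      exact one_div_le_one_div_of_le (by positivity) (pow_le_pow_left₀ hlow.le h 2)
    have hcard : ((S.filter (fun n ↦ round (zetaOrdinate n / (π * M)) = (k : ℤ))).card : ℝ) ≤ cnt := by
      refine card_fibre_le hA0 hA hM hT₂ hh0 hh hk.1 fun n hn ↦ ?_
      rw [Finset.mem_filter] at hn
      exact ⟨(hS n hn.1).1, hn.2, (hS n hn.1).2.2⟩
    calc ∑ n ∈ S.filter (fun n ↦ round (zetaOrdinate n / (π * M)) = (k : ℤ)), 1 / zetaOrdinate n ^ 2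
        ≤ ∑ n ∈ S.filter (fun n ↦ round (zetaOrdinate n / (π * M)) = (k : ℤ)),
            1 / (π * M * ((k : ℝ) - 1 / 2)) ^ 2 := Finset.sum_le_sum hpt
      _ = ((S.filter (fun n ↦ round (zetaOrdinate n / (π * M)) = (k : ℤ))).card : ℝ) *
            (1 / (π * M * ((k : ℝ) - 1 / 2)) ^ 2) := by rw [Finset.sum_const, nsmul_eq_mul]
      _ ≤ cnt * (1 / (π * M * ((k : ℝ) - 1 / 2)) ^ 2) := mul_le_mul_of_nonneg_right hcard (by positivity)
  refine (Finset.sum_le_sum hfib).trans ?_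
  rw [← Finset.mul_sum]
  have e : ∀ k ∈ Finset.Icc 1 ⌊T₂ / (π * M) + 1 / 2⌋₊,
      1 / (π * M * ((k : ℝ) - 1 / 2)) ^ 2 = 1 / (π * (M : ℝ)) ^ 2 * (1 / ((k : ℝ) - 1 / 2) ^ 2) := by
    intro k hk
    rw [Finset.mem_Icc] at hk
    have hk1 : (1 : ℝ) ≤ k := by exact_mod_cast hk.1
    have : (k : ℝ) - 1 / 2 ≠ 0 := by linarith
    field_simp
  rw [Finset.sum_congr rfl e, ← Finset.mul_sum]
  have hs := sum_inv_sub_half_sq_le ⌊T₂ / (π * M) + 1 / 2⌋₊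
  calc cnt * (1 / (π * (M : ℝ)) ^ 2 * ∑ k ∈ Finset.Icc 1 ⌊T₂ / (π * M) + 1 / 2⌋₊, 1 / ((k : ℝ) - 1 / 2) ^ 2)
      ≤ cnt * (1 / (π * (M : ℝ)) ^ 2 * (π ^ 2 / 2)) := by gcongr
    _ = A * (π * M * h + 1) * Real.log (T₂ + π * M + 3) / (M : ℝ) ^ 2 := by
        rw [hcnt]; field_simp

/-- Geometric sums: `∑_{i ≤ I} 2^i ≤ 2 · 2^I` and `∑_{i ≤ I} 4^i ≤ (4/3) 4^I`. [folklore] -/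
theorem geom_two_four_le (I : ℕ) :
    ∑ i ∈ Finset.range (I + 1), (2 : ℝ) ^ i ≤ 2 * 2 ^ I ∧
      ∑ i ∈ Finset.range (I + 1), (4 : ℝ) ^ i ≤ 4 / 3 * 4 ^ I := by
  constructor
  · rw [geom_sum_eq (by norm_num : (2 : ℝ) ≠ 1), pow_succ]
    norm_num
    linarith [pow_pos (show (0 : ℝ) < 2 by norm_num) I]
  · rw [geom_sum_eq (by norm_num : (4 : ℝ) ≠ 1), pow_succ]
    norm_num
    rw [div_le_iff₀ (by norm_num : (0 : ℝ) < 3)]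
    linarith [pow_pos (show (0 : ℝ) < 4 by norm_num) I]

/-- **Off the transition zones.** For `M ≥ 1`, `0 < δ ≤ 1/2`, `T₂ ≥ 0` and the local density `A`:
`∑_{n<N(T₂), y_n ≥ 1/2, d_n ≥ δ} 1/(γ_n² d_n²) ≤ A log(T₂ + πM + 3) (101/(δM) + 86/(δ²M²))`. [folklore] -/
theorem offZone_le {A : ℝ} (hA0 : 0 ≤ A)
    (hA : ∀ t : ℝ, 0 ≤ t → (zetaZeroCount (t + 1) : ℝ) - zetaZeroCount t ≤ A * Real.log (t + 2))
    {M : ℕ} (hM : 1 ≤ M) {δ : ℝ} (hδ0 : 0 < δ) (hδ : δ ≤ 1 / 2) {T₂ : ℝ} (hT₂ : 0 ≤ T₂) :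
    ∑ n ∈ (Finset.range (zetaZeroCount T₂)).filter (fun n ↦ 1 / 2 ≤ zetaOrdinate n / (π * M) ∧
        δ ≤ |zetaOrdinate n / (π * M) - round (zetaOrdinate n / (π * M))|),
      1 / (zetaOrdinate n ^ 2 * |zetaOrdinate n / (π * M) - round (zetaOrdinate n / (π * M))| ^ 2) ≤
      A * Real.log (T₂ + π * M + 3) * (101 / (δ * M) + 86 / (δ ^ 2 * (M : ℝ) ^ 2)) := by
  classical
  have hM1 : (1 : ℝ) ≤ M := by exact_mod_cast hM
  have hπ := Real.pi_gt_three
  have hπ4 := Real.pi_lt_d2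
  have hπM : 0 < π * (M : ℝ) := by positivity
  have hL0 : 0 ≤ Real.log (T₂ + π * M + 3) := Real.log_nonneg (by linarith)
  set L : ℝ := Real.log (T₂ + π * M + 3) with hL
  set S := (Finset.range (zetaZeroCount T₂)).filter (fun n ↦ 1 / 2 ≤ zetaOrdinate n / (π * M) ∧
    δ ≤ |zetaOrdinate n / (π * M) - round (zetaOrdinate n / (π * M))|) with hS
  set dd : ℕ → ℝ := fun n ↦ |zetaOrdinate n / (π * M) - round (zetaOrdinate n / (π * M))| with hdd
  -- the number of levels
  obtain ⟨I₀, hI₀, hI₀'⟩ := exists_nat_pow_near (show (1 : ℝ) ≤ 1 / δ by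
    rw [le_div_iff₀ hδ0]; linarith) one_lt_two
  set I : ℕ := I₀ + 1 with hI
  have hIlo : 1 / δ ≤ (2 : ℝ) ^ I := hI₀'.le
  have hIhi : (2 : ℝ) ^ I ≤ 2 / δ := by
    rw [hI, pow_succ, show (2 : ℝ) / δ = (1 / δ) * 2 by ring]
    exact mul_le_mul_of_nonneg_right hI₀ (by norm_num)
  -- termwise dyadic cover
  have hcover : ∀ n ∈ S, 1 / (zetaOrdinate n ^ 2 * dd n ^ 2) ≤
      ∑ i ∈ Finset.range (I + 1), (4 : ℝ) ^ (i + 2) *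
        (if dd n ≤ (1 / 2 : ℝ) ^ (i + 1) then 1 / zetaOrdinate n ^ 2 else 0) := by
    intro n hn
    rw [hS, Finset.mem_filter] at hn
    have hdn : δ ≤ dd n := hn.2.2
    have hd2 : dd n ≤ 1 / 2 := abs_sub_round _
    have hc := inv_sq_le_sum_levels hδ0 hdn hd2 hIlo
    have hγ : 0 < zetaOrdinate n ^ 2 := pow_pos (zetaOrdinate_pos_holds n) 2
    rw [mul_comm, ← one_div_mul_one_div]
    calc 1 / dd n ^ 2 * (1 / zetaOrdinate n ^ 2)
        ≤ (∑ i ∈ Finset.range (I + 1), (4 : ℝ) ^ (i + 2) * (if dd n ≤ (1 / 2 : ℝ) ^ (i + 1) then 1 else 0)) *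
            (1 / zetaOrdinate n ^ 2) := mul_le_mul_of_nonneg_right hc (by positivity)
      _ = _ := by
          rw [Finset.sum_mul]
          refine Finset.sum_congr rfl fun i _ ↦ ?_
          split_ifs <;> ring
  refine (Finset.sum_le_sum hcover).trans ?_
  rw [Finset.sum_comm]
  -- each level
  have hlevel : ∀ i ∈ Finset.range (I + 1),
      ∑ n ∈ S, (4 : ℝ) ^ (i + 2) * (if dd n ≤ (1 / 2 : ℝ) ^ (i + 1) then 1 / zetaOrdinate n ^ 2 else 0) ≤
        (4 : ℝ) ^ (i + 2) * (A * (π * M * (1 / 2 : ℝ) ^ (i + 1) + 1) * L / (M : ℝ) ^ 2) := by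
    intro i _
    rw [← Finset.mul_sum, ← Finset.sum_filter]
    refine mul_le_mul_of_nonneg_left ?_ (by positivity)
    have hh : (1 / 2 : ℝ) ^ (i + 1) ≤ 1 / 2 := by
      calc (1 / 2 : ℝ) ^ (i + 1) ≤ (1 / 2) ^ 1 := pow_le_pow_of_le_one (by norm_num) (by norm_num) (by omega)
        _ = 1 / 2 := pow_one _
    refine level_le hA0 hA hM (by positivity) hh hT₂ fun n hn ↦ ?_
    rw [Finset.mem_filter, hS, Finset.mem_filter, Finset.mem_range] at hn
    exact ⟨hn.1.1, hn.1.2.1, hn.2⟩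
  refine (Finset.sum_le_sum hlevel).trans ?_
  -- the geometric sums
  have e : ∀ i ∈ Finset.range (I + 1),
      (4 : ℝ) ^ (i + 2) * (A * (π * M * (1 / 2 : ℝ) ^ (i + 1) + 1) * L / (M : ℝ) ^ 2) =
        A * L / (M : ℝ) ^ 2 * (8 * π * M * 2 ^ i + 16 * 4 ^ i) := by
    intro i _
    have h44 : (4 : ℝ) ^ i = (2 ^ i) ^ 2 := by
      rw [show (4 : ℝ) = 2 ^ 2 by norm_num, ← pow_mul, mul_comm, pow_mul]
    have h4 : (4 : ℝ) ^ (i + 2) = 16 * (2 ^ i) ^ 2 := by rw [pow_add, h44]; norm_num; ring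
    have hu : (1 / 2 : ℝ) ^ (i + 1) = 1 / (2 ^ i * 2) := by rw [one_div_pow, pow_succ]
    have hX : (0 : ℝ) < 2 ^ i := by positivity
    rw [h4, h44, hu]
    field_simp
    ring
  rw [Finset.sum_congr rfl e, ← Finset.mul_sum, Finset.sum_add_distrib, ← Finset.mul_sum, ← Finset.mul_sum]
  obtain ⟨g2, g4⟩ := geom_two_four_le I
  have h2I : 0 < (2 : ℝ) ^ I := by positivity
  have hsum : 8 * π * M * ∑ i ∈ Finset.range (I + 1), (2 : ℝ) ^ i + 16 * ∑ i ∈ Finset.range (I + 1), (4 : ℝ) ^ i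
      ≤ 8 * π * M * (4 / δ) + 16 * (16 / (3 * δ ^ 2)) := by
    have h1 : ∑ i ∈ Finset.range (I + 1), (2 : ℝ) ^ i ≤ 4 / δ := by
      calc ∑ i ∈ Finset.range (I + 1), (2 : ℝ) ^ i ≤ 2 * 2 ^ I := g2
        _ ≤ 2 * (2 / δ) := by linarith
        _ = 4 / δ := by ring
    have h2 : ∑ i ∈ Finset.range (I + 1), (4 : ℝ) ^ i ≤ 16 / (3 * δ ^ 2) := by
      have h44 : (4 : ℝ) ^ I = (2 ^ I) ^ 2 := by
        rw [← pow_mul, show (4 : ℝ) = 2 ^ 2 by norm_num, ← pow_mul, mul_comm]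
      have h45 : (2 ^ I : ℝ) ^ 2 ≤ (2 / δ) ^ 2 := pow_le_pow_left₀ h2I.le hIhi 2
      calc ∑ i ∈ Finset.range (I + 1), (4 : ℝ) ^ i ≤ 4 / 3 * 4 ^ I := g4
        _ ≤ 4 / 3 * (2 / δ) ^ 2 := by rw [h44]; linarith
        _ = 16 / (3 * δ ^ 2) := by field_simp; ring
    nlinarith [mul_nonneg (by positivity : (0 : ℝ) ≤ 8 * π * M) (sub_nonneg.2 h1)]
  calc A * L / (M : ℝ) ^ 2 *
        (8 * π * M * ∑ i ∈ Finset.range (I + 1), (2 : ℝ) ^ i + 16 * ∑ i ∈ Finset.range (I + 1), (4 : ℝ) ^ i)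
      ≤ A * L / (M : ℝ) ^ 2 * (8 * π * M * (4 / δ) + 16 * (16 / (3 * δ ^ 2))) :=
        mul_le_mul_of_nonneg_left hsum (by positivity)
    _ = A * L * (32 * π / (δ * M) + 256 / 3 / (δ ^ 2 * (M : ℝ) ^ 2)) := by
        field_simp
        ring
    _ ≤ A * L * (101 / (δ * M) + 86 / (δ ^ 2 * (M : ℝ) ^ 2)) := by
        refine mul_le_mul_of_nonneg_left (add_le_add ?_ ?_) (by positivity)
        · exact div_le_div_of_nonneg_right (by nlinarith) (by positivity)
        · exact div_le_div_of_nonneg_right (by norm_num) (by positivity)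

end Summit.RiemannHypothesis.RiemannHypothesis.Theorems.EtaLeadingQuarter.Zeros

end
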